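import Mathlib
import Literature.Probability.RandomPlanarGeometry.HexSAW
import Summits.CriticalPhenomena.SAWScalingLimit.Theorems.SAWDefectDecoherenceObservableToSLERGateDefs

/-!
# Domain-adapted gates for the line `bridge-gate-renewal` (crux `ObservableToSLER`, stmt-CriticalPhenomena-14005)

Lead prover `prover-line-stmt-CriticalPhenomena-14005-1` (crux protocol, seat 2; skeleton
`Summits/CriticalPhenomena/SAWScalingLimit/Cruxes/ObservableToSLER/Lines/bridge_gate_renewal.lean`).
Companion of `Theorems/SAWDefectDecoherenceObservableToSLERGateDefs.lean` (same namespace), which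
defines the gates of the line over the FIXED foliation by lattice hexagons `hexBall (a δ) n` around
the root.  That foliation is dead: on the fat hexagonal spiral `D_hex` (crux workfile
`Cruxes/ObservableToSLER/NegativeNote-RenewalAccumulation-g2.md`, drefute gen 2, confirmed by the
lead) every level `∂(contHex) ∩ D` is one wall-to-wall diagonal of aspect `≍ 1/s` of a corridor of
width `≍ s²`, a good gate is a single crossing of it, and single crossings of such diagonals are
summably rare for SLE(8/3) — the abundance statement `RenewalAccumulation` over hexagon levels
contradicts the line's own target `HexConjecture`.  The repair keeps the composition of the line
(exact gate factorisation + abundance of single crossings + identification of the carved middle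
pieces in the two-ball flat-pinned class + Radó) but lets the gate geometry ADAPT to the domain:
the gates are the members of a family of cuts of `Ω` chosen AFTER the mesh (drefute's typed repair
shape `RenewalAccumulationAdapted`, crux workfile `NegativeNote_RepairRA3.lean`, re-typed here).

This file only DEFINES the adapted objects the reshaped stubs 2, 5, 6a, 6b of the line speak about
(precedent and style: the `GateDefs` file) — no statement of the line is asserted or named here:

* `cutSide Ω κ δ c` — the ROOT SIDE of a cut `κ ⊆ Ω`: the component of `Ω ∖ κ` containing the
  rescaled root `δ·c` (walk-independent); `cutSideVerts` — its lattice shadow;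
* `IsLatticeCarrier δ κ` — `κ` lies on `𝕋`-lines of mesh `δ` (hexagon level arcs and straight
  lattice chords both do), so that a dual edge crosses `κ` iff its gate point lies on `κ` and the
  clean flat windows of `HasCleanWindow` make sense on it;
* `IsAdmissibleFamily Ω δ R c far F` — an ADMISSIBLE GATE FAMILY for the root `c` against the far
  endpoint `far` at locality scale `R`: pairwise disjoint cuts with NESTED root sides (a chain: for
  disjoint two-sided separating cuts this is the nesting lemma `DrefuteRA3.nesting` of the crux
  workfile; it is recorded as a clause because it is the one property the product-cell step of the
  gate transfer consumes), each cut inside `Ω`, connected, relatively closed, lattice-carried,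
  TWO-SIDED (the far side `(Ω ∖ κ) ∖ cutSide` is connected and contains `δ·far`), a genuine
  crosscut (every point of `κ` is adherent to both sides — no dangling hair on either side), and
  LOCAL (`cutSide ∪ κ ⊆ B(δ·c, R)`);
* `IsCrossedOnce Ω δ ρ c κ l m p q` — the vertex list `l` crosses `κ` EXACTLY ONCE, at index `m`,
  through the dual edge `{p, q}` whose gate point lies on `κ` (prefix in the root side, suffix off
  it), with a clean flat `ρ`-window at the crossing;
* `GoodGateIn`, `IsFirstGoodGateIn` — some member of `F` is crossed once / the one with minimal
  crossing index (one per list: the index determines the edge, disjointness determines the cut);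
* `productCellIn Ω δ ρ Fa Fb a b C` — the walks whose cell (first good gates at both ends, prefix,
  suffix fixed) is a PRODUCT `{prefix} × {middle pieces avoiding both root sides} × {suffix}` with
  prefix/suffix within `C` of the junctions: verbatim the hexagon-gate `productCell` of
  `Theorems/SAWDefectDecoherenceObservableToSLERGateTransferCells.lean` over adapted gates.

Sources: H. Kesten, J. Math. Phys. 4 (1963) §4 (bridges, renewal); T. Alberts, H. Duminil-Copin,
arXiv:0909.0203 (bridge points / lines of the `5/8` restriction measure — the continuum shadow of
gate abundance at flat points); H. Duminil-Copin, S. Smirnov, Ann. of Math. 175 (2012) §4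
(`hexSAWLaw`); Ch. Pommerenke, Boundary Behaviour of Conformal Maps (1992) §2.4 (crosscuts).
Deliberately NOT here: any statement or theorem of the line (the typed statements
`RenewalAbundance`, `CarvedToSLEA`, `ProductCellStructure` live in the skeleton and, inlined, in the
stub files).
-/

noncomputable section

open scoped BigOperators Topology NNReal ENNReal Classical
open Filter Set MeasureTheory Metric
open Literature.Probability.LatticeModels (HexVertex hexGraph hexCenter triZeta Site)
open Literature.Probability.RandomPlanarGeometry
open Literature.Probability.RandomPlanarGeometry.SAW

namespace Summit.CriticalPhenomena.SAWScalingLimit.Theorems.ObservableToSLER.BridgeGate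

/-- The ROOT SIDE of a cut `κ ⊆ Ω` for the root vertex `c` at mesh `δ`: the connected component of
`Ω ∖ κ` containing the rescaled centre `δ·c` of the root (junk `∅` if `δ·c ∈ κ` or `δ·c ∉ Ω`). -/
def cutSide (Ω κ : Set ℂ) (δ : ℝ) (c : HexVertex) : Set ℂ :=
  connectedComponentIn (Ω \ κ) ((δ : ℂ) * hexCenter c)

/-- The lattice shadow of the root side: honeycomb vertices whose rescaled centre lies in it. -/
def cutSideVerts (Ω κ : Set ℂ) (δ : ℝ) (c : HexVertex) : Set HexVertex :=
  {v | (δ : ℂ) * hexCenter v ∈ cutSide Ω κ δ c}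

/-- `κ` is LATTICE-CARRIED at mesh `δ`: every point of `κ` lies on a `𝕋`-line of mesh `δ` (an
integer level of one of the three skew coordinates), as hexagon level arcs and straight lattice
chords do.  Vertex centres never lie on such lines, and a dual edge `{p,q}` meets them exactly at
its gate point. -/
def IsLatticeCarrier (δ : ℝ) (κ : Set ℂ) : Prop :=
  ∀ z ∈ κ, ∃ i : Fin 3, ∃ m : ℤ, skewCoord i (z / δ) = (m : ℝ)

/-- An ADMISSIBLE GATE FAMILY for the root `c` against the far endpoint `far` at locality scale `R`
(in the domain `Ω` at mesh `δ`): a set `F` of cuts of `Ω` which is pairwise DISJOINT with NESTED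
root sides (any two root sides are comparable), each member lying in `Ω`, connected, relatively
closed in `Ω`, lattice-carried, TWO-SIDED (its far side `(Ω ∖ κ) ∖ cutSide` is connected and
contains the rescaled far endpoint, so `κ` separates root from far end), a genuine CROSSCUT (each
point of `κ` is adherent to the root side and to the far side), and LOCAL (root side and cut inside
the open `R`-ball about the rescaled root).  The family is chosen by the user after the mesh
(`∃ F` under `∀ᶠ δ` in the abundance statement of the line). -/
def IsAdmissibleFamily (Ω : Set ℂ) (δ R : ℝ) (c far : HexVertex) (F : Set (Set ℂ)) : Prop :=
  F.PairwiseDisjoint id ∧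
    (∀ κ ∈ F, ∀ κ' ∈ F, cutSide Ω κ δ c ⊆ cutSide Ω κ' δ c ∨ cutSide Ω κ' δ c ⊆ cutSide Ω κ δ c) ∧
    ∀ κ ∈ F, κ ⊆ Ω ∧ IsConnected κ ∧ closure κ ∩ Ω ⊆ κ ∧ IsLatticeCarrier δ κ ∧
      IsConnected ((Ω \ κ) \ cutSide Ω κ δ c) ∧
      (δ : ℂ) * hexCenter far ∈ (Ω \ κ) \ cutSide Ω κ δ c ∧
      κ ⊆ closure (cutSide Ω κ δ c) ∧ κ ⊆ closure ((Ω \ κ) \ cutSide Ω κ δ c) ∧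
      cutSide Ω κ δ c ∪ κ ⊆ ball ((δ : ℂ) * hexCenter c) R

/-- The vertex list `l` (read from the root `c`) CROSSES the cut `κ` EXACTLY ONCE, at index `m`,
through the dual edge `{p, q} = {l[m-1], l[m]}`: the gate point of that edge lies on `κ`, the first
`m` entries lie in the root side of `κ`, no later entry does (single crossing — Kesten's bridge
point / the bridge line of Alberts–Duminil-Copin, bent along the cut), and the crossing carries a
clean flat window of radius `ρ` (`HasCleanWindow` relative to the root-side vertices: the far side
is, near its new root `q`, an exact half-lattice above a flat zigzag side ON a lattice line — the
root clause of `HexObservableLimitR`, in some orientation). -/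
def IsCrossedOnce (Ω : Set ℂ) (δ ρ : ℝ) (c : HexVertex) (κ : Set ℂ) (l : List HexVertex) (m : ℕ)
    (p q : HexVertex) : Prop :=
  (l.take m).getLast? = some p ∧ (l.drop m).head? = some q ∧ gatePoint δ p q ∈ κ ∧
    (∀ v ∈ l.take m, v ∈ cutSideVerts Ω κ δ c) ∧ (∀ v ∈ l.drop m, v ∉ cutSideVerts Ω κ δ c) ∧
    HasCleanWindow Ω δ ρ (cutSideVerts Ω κ δ c) p q

/-- `l` has a GOOD GATE in the family `F`: it crosses some member of `F` exactly once with a clean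
window. -/
def GoodGateIn (Ω : Set ℂ) (δ ρ : ℝ) (c : HexVertex) (F : Set (Set ℂ)) (l : List HexVertex) :
    Prop :=
  ∃ κ ∈ F, ∃ (m : ℕ) (p q : HexVertex), IsCrossedOnce Ω δ ρ c κ l m p q

/-- The FIRST GOOD GATE of `l` in the family `F`: a member `κ ∈ F` crossed exactly once (with a
clean window) at the MINIMAL crossing index among all such members.  One per list, if any: the
index determines the edge `{p, q}`, and pairwise disjointness of `F` determines the member through
the gate point. -/
def IsFirstGoodGateIn (Ω : Set ℂ) (δ ρ : ℝ) (c : HexVertex) (F : Set (Set ℂ)) (l : List HexVertex)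
    (κ : Set ℂ) (m : ℕ) (p q : HexVertex) : Prop :=
  κ ∈ F ∧ IsCrossedOnce Ω δ ρ c κ l m p q ∧
    ∀ κ' ∈ F, ∀ (m' : ℕ) (p' q' : HexVertex), IsCrossedOnce Ω δ ρ c κ' l m' p' q' → m ≤ m'

/-- **The product cells at mesh `δ` over adapted gate families** (`Fa` rooted at the start `a`,
`Fb` at the end `b`, read on the reversed list), as the set of walks `γ₀` whose cell is a product:
for all first good gates `(κ; m, p, q)` in `Fa` of `γ₀` and `(κ'; m', p', q')` in `Fb` of the
reversed list (prefix = the first `m` vertices, suffix = the last `m'`), the two root-side vertex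
sets `S`, `T` are disjoint, the prefix is a SAW of `Ω_δ` from `a` to `p` inside `S`, the suffix a
SAW from `p'` to `b` inside `T`, the two crossing edges are lattice edges of `Ω_δ`, the middle
piece is nonempty, EVERY walk `prefix ++ mid ++ suffix` with `mid` from `q` to `q'` avoiding
`S ∪ T` has the same first good gates at both ends, and the prefix (suffix) vertices are within `C`
of `q` (`q'`).  Verbatim the hexagon-gate `productCell` over adapted gates; the cell structure at
mesh `δ` is the statement that every walk lies in this set. -/
def productCellIn (Ω : Set ℂ) (δ ρ : ℝ) (Fa Fb : Set (Set ℂ)) (a b : HexVertex) (C : ℝ) :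
    Set (HexDomainSAW Ω δ a b) :=
  {γ₀ | ∀ (κ : Set ℂ) (m : ℕ) (p q : HexVertex) (κ' : Set ℂ) (m' : ℕ) (p' q' : HexVertex),
    IsFirstGoodGateIn Ω δ ρ a Fa γ₀.walk.support κ m p q →
    IsFirstGoodGateIn Ω δ ρ b Fb γ₀.walk.support.reverse κ' m' p' q' →
    Disjoint (cutSideVerts Ω κ δ a) (cutSideVerts Ω κ' δ b) ∧
    (∃ w₁ : (hexDomainGraph Ω δ).Walk a p, w₁.IsPath ∧
      w₁.support = γ₀.walk.support.take m ∧
      ∀ v ∈ γ₀.walk.support.take m, v ∈ cutSideVerts Ω κ δ a) ∧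
    (∃ w₂ : (hexDomainGraph Ω δ).Walk p' b, w₂.IsPath ∧
      w₂.support = γ₀.walk.support.drop (γ₀.walk.support.length - m') ∧
      ∀ v ∈ γ₀.walk.support.drop (γ₀.walk.support.length - m'), v ∈ cutSideVerts Ω κ' δ b) ∧
    (hexDomainGraph Ω δ).Adj p q ∧ (hexDomainGraph Ω δ).Adj q' p' ∧
    m + m' < γ₀.walk.support.length ∧
    (∀ (γ : HexDomainSAW Ω δ a b) (mid : List HexVertex), mid.head? = some q →
      mid.getLast? = some q' →
      (∀ v ∈ mid, v ∉ cutSideVerts Ω κ δ a ∧ v ∉ cutSideVerts Ω κ' δ b) →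
      γ.walk.support = γ₀.walk.support.take m ++ mid ++
        γ₀.walk.support.drop (γ₀.walk.support.length - m') →
      IsFirstGoodGateIn Ω δ ρ a Fa γ.walk.support κ m p q ∧
      IsFirstGoodGateIn Ω δ ρ b Fb γ.walk.support.reverse κ' m' p' q') ∧
    (∀ x ∈ γ₀.walk.support.take m,
      dist ((δ : ℂ) * hexCenter x) ((δ : ℂ) * hexCenter q) ≤ C) ∧
    (∀ x ∈ γ₀.walk.support.drop (γ₀.walk.support.length - m'),
      dist ((δ : ℂ) * hexCenter x) ((δ : ℂ) * hexCenter q') ≤ C)}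

/-- A first good gate is in particular a good gate (bookkeeping; registered sub-goal). -/
theorem goodGateIn_of_isFirstGoodGateIn : ∀ (Ω : Set ℂ) (δ ρ : ℝ) (c : HexVertex) (F : Set (Set ℂ)) (l : List HexVertex) (κ : Set ℂ) (m : ℕ) (p q : HexVertex), IsFirstGoodGateIn Ω δ ρ c F l κ m p q → GoodGateIn Ω δ ρ c F l :=
  fun _ _ _ _ _ _ κ m p q h => ⟨κ, h.1, m, p, q, h.2.1⟩

end Summit.CriticalPhenomena.SAWScalingLimit.Theorems.ObservableToSLER.BridgeGate

end
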